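import Mathlib
import HarnessLib
import Summits.AtomisticToContinuum.Crystallization.Theorems.FrustratedLawDichotomyAperiodicFrustratedLawGapErgodicOperator

/-!
# Ergodic reduction for the crux `AperiodicFrustratedLawGap` — fixed points of the re-rooting operator

Route `FrustratedLawDichotomy`, crux `AperiodicFrustratedLawGap` (item `stmt-AtomisticToContinuum-27623`),
registered stub `stub_ergodicReduction` (skeleton `dd3251ad731e`); eighth brick of step D5 (`hErg`; evidence
`D5-PLAN.md`, S1).  The Hilbert-space realisation of the lazy re-rooting operator: with
`π = (ν ⊗ₘ κ₀).withDensity W` (`…ErgodicCampbellWeight`), `E f = f ∘ p₁ : L²(ν) → L²(π)` (isometry,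
`measurePreserving_fst_campbell`) and `U h = h ∘ Θ : L²(π) → L²(π)` (isometry, `measurePreserving_reroot_campbell`),
the operator `P = E† ∘ U ∘ E` is a contraction of `L²(ν)` whose matrix elements are the weighted Campbell
integrals `⟪g, P f⟫ = ∫ g(p.1) f((Θ p).1) dπ(p)` — by `…ErgodicMatrixElement` these are the matrix elements of
the pointwise lazy re-rooting operator.  Stated as an existence result (no definition is introduced):

* `LinearIsometry.comp_eq_of_adjoint_comp_fixed` — Hilbert-space lemma: for linear isometries `E`, `U`, a
  vector `x` with `E† (U (E x)) = x` satisfies `U (E x) = E x` (equality case of Cauchy–Schwarz);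
* `exists_rerootOperator_fix` — the operator of `…ErgodicOperator.exists_rerootOperator` (same construction,
  restated with one more conjunct): every FIXED POINT `P [h] = [h]` is invariant along `π`-almost every edge,
  `h((Θ q).1) = h(q.1)` for `π`-a.e. `q` — whence, by `exists_invariant_ae_eq_of_campbell`, `ν`-a.e. equal to an
  exactly re-rooting-invariant function.  With the mean ergodic theorem
  (`ContinuousLinearMap.tendsto_birkhoffAverage_orthogonalProjection`, applicable since `‖P‖ ≤ 1`) this identifies
  the limit of the Cesàro averages as the projection onto invariant functions (step S1 of `D5-PLAN.md`).
`[folklore]`.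
-/

noncomputable section

namespace Summit.AtomisticToContinuum.Crystallization.Theorems.FrustratedLawDichotomyErgodicReduction

open MeasureTheory Set Filter ProbabilityTheory
open scoped ENNReal Classical InnerProductSpace
open Literature.Probability.Process (LocalConfig)
open Literature.Probability.Process.LocalConfig (RootedHardCoreConfig toMeasure_def measurable_toMeasure)
open Summit.AtomisticToContinuum.Crystallization.Theorems.BenjaminiSchrammLimit (isSFiniteKernel_toMeasure
  measurable_reroot)

variable {δ : ℝ}

/-- **Fixed points of `E† U E` are fixed by `U` after embedding.**  For linear isometries `E : H₁ → H₂`,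
`U : H₂ → H₂` of real Hilbert spaces and `x` with `E† (U (E x)) = x`: `U (E x) = E x`, since
`⟪E x, U E x⟫ = ⟪x, E† U E x⟫ = ‖x‖² = ‖E x‖²` and `‖U E x‖ = ‖E x‖` force `‖U E x − E x‖² = 0`. [folklore] -/
theorem LinearIsometry.comp_eq_of_adjoint_comp_fixed {H₁ H₂ : Type*} [NormedAddCommGroup H₁]
    [InnerProductSpace ℝ H₁] [CompleteSpace H₁] [NormedAddCommGroup H₂] [InnerProductSpace ℝ H₂]
    [CompleteSpace H₂] (E : H₁ →ₗᵢ[ℝ] H₂) (U : H₂ →ₗᵢ[ℝ] H₂) (x : H₁)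
    (hx : ContinuousLinearMap.adjoint E.toContinuousLinearMap (U (E x)) = x) : U (E x) = E x := by
  have h1 : ⟪U (E x), E x⟫_ℝ = ‖E x‖ ^ 2 := by
    have h : ⟪x, ContinuousLinearMap.adjoint E.toContinuousLinearMap (U (E x))⟫_ℝ = ⟪x, x⟫_ℝ := by rw [hx]
    rw [ContinuousLinearMap.adjoint_inner_right, LinearIsometry.coe_toContinuousLinearMap,
      real_inner_self_eq_norm_sq] at h
    rw [real_inner_comm, h, E.norm_map]
  have h2 : ‖U (E x)‖ = ‖E x‖ := U.norm_map _
  have h3 : ‖U (E x) - E x‖ ^ 2 = 0 := by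
    rw [norm_sub_sq_real, h2, h1]
    ring
  rwa [sq_eq_zero_iff, norm_eq_zero, sub_eq_zero] at h3

/-- **The re-rooting operator on `L²(ν)`** (`δ > 0`).  For a probability law `ν` on rooted `δ`-hard-core
configurations of `ℝ³` with Campbell measure invariant under the re-rooting involution `Θ`, and a measurable
even weight `w` of mass `≤ 1` on every configuration, there is a bounded operator `P` on `L²(ν)` with
`‖P‖ ≤ 1` and matrix elements `⟪g, P f⟫ = ∫ g(p.1) f((Θ p).1) dπ(p)`, `π = (ν ⊗ₘ κ₀).withDensity W`,
`W(S,y) = w(y) + (1 − Σ_{z∈S} w(z)) 1[y = 0]`: namely `P = E† ∘ U ∘ E` with `E f = f ∘ p₁`, `U h = h ∘ Θ`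
(`MeasureTheory.Lp.compMeasurePreservingₗᵢ`). [folklore] -/
theorem exists_rerootOperator_fix [Fact (0 < δ)]
    {ν : Measure (RootedHardCoreConfig (EuclideanSpace ℝ (Fin 3)) δ)} [IsProbabilityMeasure ν]
    (hinv : haveI := isSFiniteKernel_toMeasure (E := EuclideanSpace ℝ (Fin 3)) (δ := δ)
      (ν ⊗ₘ (⟨fun S : RootedHardCoreConfig (EuclideanSpace ℝ (Fin 3)) δ =>
        (S.1 : LocalConfig (EuclideanSpace ℝ (Fin 3))).toMeasure,
        measurable_toMeasure (Fact.out : 0 < δ)⟩ :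
        Kernel (RootedHardCoreConfig (EuclideanSpace ℝ (Fin 3)) δ) (EuclideanSpace ℝ (Fin 3)))).map
      (fun p : RootedHardCoreConfig (EuclideanSpace ℝ (Fin 3)) δ × EuclideanSpace ℝ (Fin 3) =>
        ((if h : p.2 ∈ ((p.1.1 : LocalConfig (EuclideanSpace ℝ (Fin 3))) : Set (EuclideanSpace ℝ (Fin 3)))
          then p.1.reroot p.2 h else p.1 : RootedHardCoreConfig (EuclideanSpace ℝ (Fin 3)) δ), -p.2)) =
      ν ⊗ₘ (⟨fun S : RootedHardCoreConfig (EuclideanSpace ℝ (Fin 3)) δ =>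
        (S.1 : LocalConfig (EuclideanSpace ℝ (Fin 3))).toMeasure,
        measurable_toMeasure (Fact.out : 0 < δ)⟩ :
        Kernel (RootedHardCoreConfig (EuclideanSpace ℝ (Fin 3)) δ) (EuclideanSpace ℝ (Fin 3))))
    {w : EuclideanSpace ℝ (Fin 3) → ℝ≥0∞} (hw : Measurable w) (hws : ∀ y, w (-y) = w y)
    (hw1 : ∀ S : RootedHardCoreConfig (EuclideanSpace ℝ (Fin 3)) δ,
      ∫⁻ y, w y ∂((S.1 : LocalConfig (EuclideanSpace ℝ (Fin 3))).toMeasure) ≤ 1) :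
    ∃ P : Lp ℝ 2 ν →L[ℝ] Lp ℝ 2 ν, ‖P‖ ≤ 1 ∧
      (∀ (f g : RootedHardCoreConfig (EuclideanSpace ℝ (Fin 3)) δ → ℝ) (hf : MemLp f 2 ν) (hg : MemLp g 2 ν),
        ⟪hg.toLp g, P (hf.toLp f)⟫_ℝ =
          ∫ q, g q.1 * f ((fun p : RootedHardCoreConfig (EuclideanSpace ℝ (Fin 3)) δ × EuclideanSpace ℝ (Fin 3) =>
            ((if h : p.2 ∈ ((p.1.1 : LocalConfig (EuclideanSpace ℝ (Fin 3))) : Set (EuclideanSpace ℝ (Fin 3)))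
              then p.1.reroot p.2 h else p.1 : RootedHardCoreConfig (EuclideanSpace ℝ (Fin 3)) δ), -p.2)) q).1
          ∂(haveI := isSFiniteKernel_toMeasure (E := EuclideanSpace ℝ (Fin 3)) (δ := δ)
            ((ν ⊗ₘ (⟨fun S : RootedHardCoreConfig (EuclideanSpace ℝ (Fin 3)) δ =>
                (S.1 : LocalConfig (EuclideanSpace ℝ (Fin 3))).toMeasure,
                measurable_toMeasure (Fact.out : 0 < δ)⟩ :
                Kernel (RootedHardCoreConfig (EuclideanSpace ℝ (Fin 3)) δ) (EuclideanSpace ℝ (Fin 3)))).withDensity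
              (fun p : RootedHardCoreConfig (EuclideanSpace ℝ (Fin 3)) δ × EuclideanSpace ℝ (Fin 3) =>
                w p.2 + (1 - ∫⁻ z, w z ∂((p.1.1 : LocalConfig (EuclideanSpace ℝ (Fin 3))).toMeasure)) *
                  ({(0 : EuclideanSpace ℝ (Fin 3))} : Set (EuclideanSpace ℝ (Fin 3))).indicator
                    (fun _ => (1 : ℝ≥0∞)) p.2)))) ∧
      ∀ (h : RootedHardCoreConfig (EuclideanSpace ℝ (Fin 3)) δ → ℝ) (hh : MemLp h 2 ν),
        P (hh.toLp h) = hh.toLp h →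
          ∀ᵐ q ∂(haveI := isSFiniteKernel_toMeasure (E := EuclideanSpace ℝ (Fin 3)) (δ := δ)
            ((ν ⊗ₘ (⟨fun S : RootedHardCoreConfig (EuclideanSpace ℝ (Fin 3)) δ =>
                (S.1 : LocalConfig (EuclideanSpace ℝ (Fin 3))).toMeasure,
                measurable_toMeasure (Fact.out : 0 < δ)⟩ :
                Kernel (RootedHardCoreConfig (EuclideanSpace ℝ (Fin 3)) δ) (EuclideanSpace ℝ (Fin 3)))).withDensity
              (fun p : RootedHardCoreConfig (EuclideanSpace ℝ (Fin 3)) δ × EuclideanSpace ℝ (Fin 3) =>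
                w p.2 + (1 - ∫⁻ z, w z ∂((p.1.1 : LocalConfig (EuclideanSpace ℝ (Fin 3))).toMeasure)) *
                  ({(0 : EuclideanSpace ℝ (Fin 3))} : Set (EuclideanSpace ℝ (Fin 3))).indicator
                    (fun _ => (1 : ℝ≥0∞)) p.2))),
            h ((fun p : RootedHardCoreConfig (EuclideanSpace ℝ (Fin 3)) δ × EuclideanSpace ℝ (Fin 3) =>
              ((if h : p.2 ∈ ((p.1.1 : LocalConfig (EuclideanSpace ℝ (Fin 3))) : Set (EuclideanSpace ℝ (Fin 3)))
                then p.1.reroot p.2 h else p.1 : RootedHardCoreConfig (EuclideanSpace ℝ (Fin 3)) δ), -p.2)) q).1 =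
            h q.1 := by
  haveI := isSFiniteKernel_toMeasure (E := EuclideanSpace ℝ (Fin 3)) (δ := δ)
  have hΘmp := measurePreserving_reroot_campbell (δ := δ) hinv hw hws
  have hfst := measurePreserving_fst_campbell (δ := δ) ν hw hw1
  -- name the involution and the weighted Campbell measure
  set Θ' : RootedHardCoreConfig (EuclideanSpace ℝ (Fin 3)) δ × EuclideanSpace ℝ (Fin 3) →
      RootedHardCoreConfig (EuclideanSpace ℝ (Fin 3)) δ × EuclideanSpace ℝ (Fin 3) :=
    fun p => ((if h : p.2 ∈ ((p.1.1 : LocalConfig (EuclideanSpace ℝ (Fin 3))) : Set (EuclideanSpace ℝ (Fin 3)))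
      then p.1.reroot p.2 h else p.1 : RootedHardCoreConfig (EuclideanSpace ℝ (Fin 3)) δ), -p.2) with hΘ'_def
  set π : Measure (RootedHardCoreConfig (EuclideanSpace ℝ (Fin 3)) δ × EuclideanSpace ℝ (Fin 3)) :=
    ((ν ⊗ₘ (⟨fun S : RootedHardCoreConfig (EuclideanSpace ℝ (Fin 3)) δ =>
        (S.1 : LocalConfig (EuclideanSpace ℝ (Fin 3))).toMeasure,
        measurable_toMeasure (Fact.out : 0 < δ)⟩ :
        Kernel (RootedHardCoreConfig (EuclideanSpace ℝ (Fin 3)) δ) (EuclideanSpace ℝ (Fin 3)))).withDensity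
      (fun p : RootedHardCoreConfig (EuclideanSpace ℝ (Fin 3)) δ × EuclideanSpace ℝ (Fin 3) =>
        w p.2 + (1 - ∫⁻ z, w z ∂((p.1.1 : LocalConfig (EuclideanSpace ℝ (Fin 3))).toMeasure)) *
          ({(0 : EuclideanSpace ℝ (Fin 3))} : Set (EuclideanSpace ℝ (Fin 3))).indicator
            (fun _ => (1 : ℝ≥0∞)) p.2)) with hπ_def
  -- the two isometries
  set E : Lp ℝ 2 ν →ₗᵢ[ℝ] Lp ℝ 2 π :=
    Lp.compMeasurePreservingₗᵢ ℝ (Prod.fst : RootedHardCoreConfig (EuclideanSpace ℝ (Fin 3)) δ ×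
      EuclideanSpace ℝ (Fin 3) → RootedHardCoreConfig (EuclideanSpace ℝ (Fin 3)) δ) hfst with hE_def
  set U : Lp ℝ 2 π →ₗᵢ[ℝ] Lp ℝ 2 π := Lp.compMeasurePreservingₗᵢ ℝ Θ' hΘmp with hU_def
  refine ⟨(ContinuousLinearMap.adjoint E.toContinuousLinearMap).comp
    (U.toContinuousLinearMap.comp E.toContinuousLinearMap), ?_, ?_, ?_⟩
  · -- `‖E† U E‖ ≤ 1`
    have hE1 : ‖E.toContinuousLinearMap‖ ≤ 1 := E.norm_toContinuousLinearMap_le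
    have hU1 : ‖U.toContinuousLinearMap‖ ≤ 1 := U.norm_toContinuousLinearMap_le
    have hEa : ‖ContinuousLinearMap.adjoint E.toContinuousLinearMap‖ ≤ 1 := by
      rw [LinearIsometryEquiv.norm_map]
      exact hE1
    calc ‖(ContinuousLinearMap.adjoint E.toContinuousLinearMap).comp
          (U.toContinuousLinearMap.comp E.toContinuousLinearMap)‖
        ≤ ‖ContinuousLinearMap.adjoint E.toContinuousLinearMap‖ *
            ‖U.toContinuousLinearMap.comp E.toContinuousLinearMap‖ := ContinuousLinearMap.opNorm_comp_le _ _
      _ ≤ 1 * (1 * 1) := by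
          refine mul_le_mul hEa ((ContinuousLinearMap.opNorm_comp_le _ _).trans
            (mul_le_mul hU1 hE1 (norm_nonneg _) zero_le_one)) (norm_nonneg _) zero_le_one
      _ = 1 := by norm_num
  · intro f g hf hg
    rw [ContinuousLinearMap.comp_apply, ContinuousLinearMap.comp_apply,
      ContinuousLinearMap.adjoint_inner_right]
    simp only [LinearIsometry.coe_toContinuousLinearMap]
    rw [MeasureTheory.L2.inner_def]
    -- the three a.e. identifications
    have h1 : ⇑(E (hg.toLp g)) =ᵐ[π] g ∘ Prod.fst :=
      (Lp.coeFn_compMeasurePreserving _ hfst).trans (hfst.quasiMeasurePreserving.ae_eq_comp hg.coeFn_toLp)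
    have h2 : ⇑(E (hf.toLp f)) =ᵐ[π] f ∘ Prod.fst :=
      (Lp.coeFn_compMeasurePreserving _ hfst).trans (hfst.quasiMeasurePreserving.ae_eq_comp hf.coeFn_toLp)
    have h3 : ⇑(U (E (hf.toLp f))) =ᵐ[π] (f ∘ Prod.fst) ∘ Θ' :=
      (Lp.coeFn_compMeasurePreserving _ hΘmp).trans (hΘmp.quasiMeasurePreserving.ae_eq_comp h2)
    refine integral_congr_ae ?_
    filter_upwards [h1, h3] with q hq1 hq3
    rw [hq1, hq3]
    simp only [Function.comp_apply, RCLike.inner_apply, conj_trivial]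
    ring
  · intro h hh hfix
    have hfix' : ContinuousLinearMap.adjoint E.toContinuousLinearMap (U (E (hh.toLp h))) = hh.toLp h := by
      simpa only [ContinuousLinearMap.comp_apply, LinearIsometry.coe_toContinuousLinearMap] using hfix
    have hUE := LinearIsometry.comp_eq_of_adjoint_comp_fixed E U (hh.toLp h) hfix'
    have h2 : ⇑(E (hh.toLp h)) =ᵐ[π] h ∘ Prod.fst :=
      (Lp.coeFn_compMeasurePreserving _ hfst).trans (hfst.quasiMeasurePreserving.ae_eq_comp hh.coeFn_toLp)
    have h3 : ⇑(U (E (hh.toLp h))) =ᵐ[π] (h ∘ Prod.fst) ∘ Θ' :=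
      (Lp.coeFn_compMeasurePreserving _ hΘmp).trans (hΘmp.quasiMeasurePreserving.ae_eq_comp h2)
    rw [hUE] at h3
    filter_upwards [h2, h3] with q hq2 hq3
    have hq := hq3.symm.trans hq2
    simpa only [Function.comp_apply] using hq

end Summit.AtomisticToContinuum.Crystallization.Theorems.FrustratedLawDichotomyErgodicReduction

end
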